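import Mathlib.RingTheory.Etale.Locus
import Mathlib.RingTheory.Etale.Field
import Mathlib.RingTheory.Localization.Integral
import Mathlib.RingTheory.Localization.Away.Basic
import Mathlib.RingTheory.Algebraic.Integral
import Mathlib.RingTheory.FinitePresentation
import Mathlib.RingTheory.DedekindDomain.IntegralClosure
import Mathlib.FieldTheory.Perfect
import HarnessLib

/-!
# Generic finiteness and generic étaleness of a finitely generated algebraic extension of domains

Topic `Literature/RingTheory/Etale`. Two standard "spreading out" steps of commutative algebra,
in the ring-theoretic form used by Cassels' embedding theorem (J. W. S. Cassels, *An embedding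
theorem for fields*, 1976, proof of Thm. I: a finitely generated field `k = ℚ(x₁,…,x_m)(θ)` with
`x` a transcendence basis and `θ` integral over `ℤ[x]` — after multiplying by a denominator — whose
minimal polynomial `H(x, Y)` has a non-vanishing discriminant `Δ(x)`, i.e. `ℤ[x, 1/Δ][θ]` is étale
over `ℤ[x, 1/Δ]`):

* `exists_isIntegral_away` — **generic finiteness.** Let `B ⊆ R` be integral domains with `R` of
  finite type and algebraic over `B`. Then for some `c ≠ 0` in `B`, `R[1/c]` is integral (hence
  finite) over `B[1/c]` (each of the finitely many generators has an integral `B`-multiple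
  `b_i • x_i`, Mathlib `IsAlgebraic.exists_integral_multiple`; take `c = ∏ b_i`). The conclusion is
  stated for arbitrary localisations `Bc`, `Rc` at `c` (`IsLocalization.Away`).
* `exists_etale_away` — **generic étaleness.** Let `B ⊆ R` be integral domains, `B` Noetherian of
  characteristic zero, `R` of finite type and algebraic over `B`. Then for some `f ≠ 0` in `R`,
  `R[1/f]` is étale over `B` (the generic point of `Spec R` lies in the open étale locus, Mathlib
  `Algebra.exists_etale_of_isEtaleAt`, because `Frac R / Frac B` is a finite separable extension,
  hence formally étale — Matsumura, *Commutative Ring Theory*, Thm. 26.9 / Mathlib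
  `Algebra.FormallyEtale.of_isSeparable`).

Everything is proved; no definitions, no named facts.

## References

* [Cassels1976] J. W. S. Cassels, An embedding theorem for fields, Bull. Austral. Math. Soc. 14
  (1976) 193–198, proof of Thm. I.
* [Matsumura1987] H. Matsumura, Commutative Ring Theory, CUP, Thm. 26.9 (separable field
  extensions are `0`-smooth).
-/

noncomputable section

namespace Literature.RingTheory.Etale

open Algebra Polynomial

/-! ## Generic finiteness -/

section Integral

variable {B R : Type*} [CommRing B] [CommRing R] [Algebra B R]

/-- If `x` has an integral multiple `b • x` and `b` becomes a unit in a `B`-algebra `Bc` over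
which `Rc ⊇ R` is an algebra, then the image of `x` in `Rc` is integral over `Bc`. [folklore] -/
private theorem isIntegral_algebraMap_of_smul {Bc Rc : Type*} [CommRing Bc] [CommRing Rc]
    [Algebra B Bc] [Algebra R Rc] [Algebra Bc Rc] [Algebra B Rc] [IsScalarTower B Bc Rc]
    [IsScalarTower B R Rc] {b : B} {x : R} (hbx : IsIntegral B (b • x))
    (hb : IsUnit (algebraMap B Bc b)) : IsIntegral Bc (algebraMap R Rc x) := by
  obtain ⟨u, hu⟩ := hb
  have h1 : IsIntegral Bc (algebraMap R Rc (b • x)) :=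
    (hbx.map (IsScalarTower.toAlgHom B R Rc)).tower_top
  have h2 : algebraMap R Rc x =
      algebraMap Bc Rc (↑u⁻¹ : Bc) * algebraMap R Rc (b • x) := by
    rw [Algebra.smul_def, map_mul, ← IsScalarTower.algebraMap_apply,
      IsScalarTower.algebraMap_apply B Bc Rc, ← hu, ← mul_assoc, ← map_mul, Units.inv_mul,
      map_one, one_mul]
  rw [h2]
  exact (isIntegral_algebraMap).mul h1

/-- **Generic finiteness** (the "clearing denominators" step in Cassels 1976, proof of Thm. I; a
standard spreading-out lemma). Let `B → R` be an injective map of integral domains with `R` of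
finite type and algebraic over `B`. Then there is `c ≠ 0` in `B` such that for ALL localisations
`Bc = B[1/c]` and `Rc = R[1/c]` (any `IsLocalization.Away` models, compatibly `B`-algebras), `Rc` is
integral over `Bc` — so `Rc`, being of finite type, is finite over `Bc`. Proof: the finitely many
generators `x_i` of `R` have integral multiples `b_i • x_i`, `b_i ≠ 0`
(Mathlib `IsAlgebraic.exists_integral_multiple`); with `c = ∏ b_i` every `b_i` is a unit in `B[1/c]`,
so every generator, hence every element of `R`, becomes integral, and so does `1/c`.
[cite: Cassels1976, proof of Thm. I] -/
theorem exists_isIntegral_away [IsDomain B] [IsDomain R] [FaithfulSMul B R]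
    [Algebra.FiniteType B R] [Algebra.IsAlgebraic B R] :
    ∃ c : B, c ≠ 0 ∧ ∀ (Bc Rc : Type*) [CommRing Bc] [CommRing Rc] [Algebra B Bc]
      [IsLocalization.Away c Bc] [Algebra R Rc] [IsLocalization.Away (algebraMap B R c) Rc]
      [Algebra Bc Rc] [Algebra B Rc] [IsScalarTower B Bc Rc] [IsScalarTower B R Rc],
      Algebra.IsIntegral Bc Rc := by
  classical
  obtain ⟨s, hs⟩ := Algebra.FiniteType.out (R := B) (A := R)
  -- integral multiples of the generators
  have hmult : ∀ x : R, ∃ b : B, b ≠ 0 ∧ IsIntegral B (b • x) := fun x =>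
    (Algebra.IsAlgebraic.isAlgebraic (R := B) x).exists_integral_multiple
  choose b hb0 hbint using hmult
  refine ⟨∏ x ∈ s, b x, Finset.prod_ne_zero_iff.2 fun x _ => hb0 x, ?_⟩
  intro Bc Rc _ _ _ _ _ _ _ _ _ _
  set c : B := ∏ x ∈ s, b x with hc
  have hcunit : IsUnit (algebraMap B Bc c) := IsLocalization.Away.algebraMap_isUnit c
  -- every generator divides `c`, hence becomes a unit in `Bc`
  have hbunit : ∀ x ∈ s, IsUnit (algebraMap B Bc (b x)) := by
    intro x hx
    obtain ⟨d, hd⟩ : b x ∣ c := Finset.dvd_prod_of_mem b hx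
    rw [hd, map_mul] at hcunit
    exact isUnit_of_mul_isUnit_left hcunit
  -- every element of `R` becomes integral over `Bc`
  have hR : ∀ r : R, IsIntegral Bc (algebraMap R Rc r) := by
    intro r
    have hr : r ∈ Algebra.adjoin B (s : Set R) := by rw [hs]; exact Algebra.mem_top
    induction hr using Algebra.adjoin_induction with
    | mem x hx => exact isIntegral_algebraMap_of_smul (hbint x) (hbunit x hx)
    | algebraMap r =>
      rw [← IsScalarTower.algebraMap_apply, IsScalarTower.algebraMap_apply B Bc Rc]
      exact isIntegral_algebraMap
    | add x y _ _ hx hy => rw [map_add]; exact hx.add hy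
    | mul x y _ _ hx hy => rw [map_mul]; exact hx.mul hy
  -- and so does every element of `Rc = R[1/c]`
  refine ⟨fun z => ?_⟩
  obtain ⟨n, r, hz⟩ := IsLocalization.Away.surj (algebraMap B R c) z
  obtain ⟨u, hu⟩ := hcunit
  have hcRc : algebraMap R Rc (algebraMap B R c) = algebraMap Bc Rc (u : Bc) := by
    rw [← IsScalarTower.algebraMap_apply, IsScalarTower.algebraMap_apply B Bc Rc, hu]
  have hz' : z = algebraMap Bc Rc (↑(u⁻¹ ^ n) : Bc) * algebraMap R Rc r := by
    have h1 : z * algebraMap Bc Rc (↑(u ^ n) : Bc) = algebraMap R Rc r := by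
      rw [Units.val_pow_eq_pow_val, map_pow, ← hcRc]; exact hz
    rw [← h1, mul_left_comm, ← map_mul, ← Units.val_mul, inv_pow, inv_mul_cancel,
      Units.val_one, map_one, mul_one]
  rw [hz']
  exact isIntegral_algebraMap.mul (hR r)

end Integral

/-! ## Generic étaleness -/

section Etale

variable (B R : Type*) [CommRing B] [CommRing R] [Algebra B R]

/-- The fraction field extension of an injective algebraic extension of domains `B ⊆ R` in
characteristic zero is formally étale over `B`: `B → Frac B` is a localisation and
`Frac R / Frac B` is algebraic and separable (Matsumura Thm. 26.9; Mathlib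
`Algebra.FormallyEtale.of_isSeparable`). [cite: Matsumura1987, Thm. 26.9] -/
theorem formallyEtale_fractionRing [IsDomain B] [IsDomain R] [FaithfulSMul B R] [CharZero B]
    [Algebra.IsAlgebraic B R] : Algebra.FormallyEtale B (FractionRing R) := by
  set K := FractionRing B
  set L := FractionRing R
  haveI : FaithfulSMul B L := by
    rw [faithfulSMul_iff_algebraMap_injective, IsScalarTower.algebraMap_eq B R L]
    exact (IsFractionRing.injective R L).comp (FaithfulSMul.algebraMap_injective B R)
  letI : Algebra K L := FractionRing.liftAlgebra B L
  haveI : IsScalarTower B K L := FractionRing.isScalarTower_liftAlgebra B L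
  haveI : CharZero K := charZero_of_injective_algebraMap (IsFractionRing.injective B K)
  haveI : Algebra.IsAlgebraic B L := (IsFractionRing.isAlgebraic_iff' B R L).1 inferInstance
  haveI : Algebra.IsAlgebraic K L :=
    Algebra.IsAlgebraic.extendScalars (R := B) (S := K) (A := L) (IsFractionRing.injective B K)
  haveI : Algebra.IsSeparable K L := Algebra.IsAlgebraic.isSeparable_of_perfectField
  haveI : Algebra.FormallyEtale K L := Algebra.FormallyEtale.of_isSeparable K L
  haveI : Algebra.FormallyEtale B K := Algebra.FormallyEtale.of_isLocalization (nonZeroDivisors B)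
  exact Algebra.FormallyEtale.comp B K L

/-- An injective algebraic extension of domains `B ⊆ R` in characteristic zero is étale at the
generic point of `Spec R` (transport of `formallyEtale_fractionRing` to the local ring of `R` at
`(0)`, which is a fraction field of `R`). [cite: Matsumura1987, Thm. 26.9] -/
theorem isEtaleAt_bot [IsDomain B] [IsDomain R] [FaithfulSMul B R] [CharZero B]
    [Algebra.IsAlgebraic B R] : Algebra.IsEtaleAt B (⊥ : Ideal R) := by
  set L := FractionRing R
  haveI : IsLocalization (nonZeroDivisors R) (Localization.AtPrime (⊥ : Ideal R)) := by
    convert (inferInstance :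
      IsLocalization (⊥ : Ideal R).primeCompl (Localization.AtPrime (⊥ : Ideal R)))
    exact (Ideal.primeCompl_bot (α := R)).symm
  let e : Localization.AtPrime (⊥ : Ideal R) ≃ₐ[B] L :=
    (IsLocalization.algEquiv (nonZeroDivisors R) (Localization.AtPrime (⊥ : Ideal R)) L
      ).restrictScalars B
  haveI : Algebra.FormallyEtale B L := formallyEtale_fractionRing B R
  exact Algebra.FormallyEtale.of_equiv e.symm

/-- **Generic étaleness** (the discriminant step `Δ(x) ≠ 0` in Cassels 1976, proof of Thm. I; EGA IV
style: a morphism of finite presentation which is étale at a point is étale on a neighbourhood). Let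
`B → R` be an injective map of integral domains, `B` Noetherian of characteristic zero, `R` of finite
type and algebraic over `B`. Then there is `f ≠ 0` in `R` with `R[1/f]` étale over `B`: the étale
locus of the finitely presented `B`-algebra `R` is open (Mathlib `Algebra.isOpen_etaleLocus`) and
contains the generic point (`isEtaleAt_bot`). [cite: Cassels1976, proof of Thm. I] -/
theorem exists_etale_away [IsDomain B] [IsDomain R] [FaithfulSMul B R] [CharZero B]
    [IsNoetherianRing B] [Algebra.FiniteType B R] [Algebra.IsAlgebraic B R] :
    ∃ f : R, f ≠ 0 ∧ Algebra.Etale B (Localization.Away f) := by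
  haveI : Algebra.FinitePresentation B R :=
    (Algebra.FinitePresentation.of_finiteType (R := B) (A := R)).1 inferInstance
  haveI : Algebra.IsEtaleAt B (⊥ : Ideal R) := isEtaleAt_bot B R
  obtain ⟨f, hf, het⟩ := Algebra.exists_etale_of_isEtaleAt (R := B) (⊥ : Ideal R)
  exact ⟨f, fun h => hf (h ▸ (Submodule.zero_mem ⊥)), het⟩

end Etale

end Literature.RingTheory.Etale

end
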